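import Mathlib
import Literature.NumberTheory.EllipticCurves.HeegnerPoints
import Literature.NumberTheory.EllipticCurves.AnalyticRank
import Literature.NumberTheory.EllipticCurves.QuadraticTwist

/-!
# Transfer lens g20 (seat bsd-idea-18) — typed companions of memo `R8-X12-bsd-idea-18-g20.md`

Crux `HeegnerTwistCouplingInSupply` (stmt-BirchSwinnertonDyer-21381), j = 0 / X12 corner
(`W = y² = x³ − p³`, `p ≡ 11 (mod 12)`; Heegner field `ℚ(√−ℓ)`, `ℓ ≡ 23 (mod 24)`, `(ℓ/p) = −1`;
twist to certify `E_{pℓ} : y² = x³ + (pℓ)³ = (36a1)^{(pℓ)}`).  Nothing here is an item, a stub or a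
skeleton; these are `Prop`s only (W-71/W-79).  `R8X12`/`R8X12Flip` are THEOREMS on paper (memo §2,
genus theory + Rédei reciprocity; numerically 0 exceptions in ≈ 33 000 representations); `J0L8` is the
conjectural elliptic-curve half (memo §5); `Linnik2Supply` is the open analytic supply statement
(GRH-trivial, memo §4).  BSD is not proved by any of this.
-/

namespace Summit.BirchSwinnertonDyer.BirchSwinnertonDyer.Cruxes.HeegnerTwistCouplingInSupply.TransferG20

open Literature.NumberTheory.EllipticCurves

/-- The X12 corner parameters: primes `p ≡ 11 (mod 12)`, `ℓ ≡ 23 (mod 24)` with `(ℓ/p) = −1`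
(equivalently, given `ℓ ≡ 23 (mod 24)`: `ℓ` splits in `ℚ(√(3p))`). -/
def IsX12Pair (p ℓ : ℕ) : Prop :=
  p.Prime ∧ ℓ.Prime ∧ p % 12 = 11 ∧ ℓ % 24 = 23 ∧ jacobiSym (ℓ : ℤ) p = -1

/-- **R8-X12** (branch `4 ∤ z`).  For an X12 pair and `K = ℚ(√(−3pℓ))` (discriminant `−3pℓ`):
for every primitive solution of `x² + ℓ z² = 3 p y²` with `4 ∤ z`,
`16 ∣ h(K)` (i.e. `r₈(Cl K) = 1`; here `Cl(K)[2^∞] ≅ ℤ/2 × ℤ/2^k`, `k ≥ 2`) iff `x ≡ ±1 (mod 12)`.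
Primitivity `gcd(x,y,z) = 1` is equivalent to `gcd(x,z) = 1` on this conic. -/
def R8X12 : Prop :=
  ∀ (p ℓ : ℕ), IsX12Pair p ℓ →
  ∀ (K : Type) [Field K] [NumberField K], IsImaginaryQuadratic K →
    NumberField.discr K = -(3 * p * ℓ : ℤ) →
  ∀ (x y z : ℤ), x ^ 2 + ℓ * z ^ 2 = 3 * p * y ^ 2 → Int.gcd x z = 1 → ¬ (4 : ℤ) ∣ z →
    (16 ∣ NumberField.classNumber K ↔ (x % 12 = 1 ∨ x % 12 = 11))

/-- **R8-X12, flipped branch** (`4 ∣ z`): the residue classes of `x` are exchanged. -/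
def R8X12Flip : Prop :=
  ∀ (p ℓ : ℕ), IsX12Pair p ℓ →
  ∀ (K : Type) [Field K] [NumberField K], IsImaginaryQuadratic K →
    NumberField.discr K = -(3 * p * ℓ : ℤ) →
  ∀ (x y z : ℤ), x ^ 2 + ℓ * z ^ 2 = 3 * p * y ^ 2 → Int.gcd x z = 1 → (4 : ℤ) ∣ z →
    (16 ∣ NumberField.classNumber K ↔ (x % 12 = 5 ∨ x % 12 = 7))

/-- `36a1 : y² = x³ + 1`; `E36.quadraticTwist M = ⟨0,0,0,0,M³⟩ = y² = x³ + M³`. -/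
def E36 : WeierstrassCurve ℚ := ⟨0, 0, 0, 0, 1⟩

/-- **(J0-L8)**, the conjectural elliptic-curve half (the direction the crux needs):
`16 ∤ h(−3pℓ)` (`r₈ = 0`) ⟹ `L(E_{pℓ}, 1) ≠ 0` for `E_{pℓ} = (36a1)^{(pℓ)}`.
Verified numerically 50/50 (both directions, with `Ш[2^∞] ≅ (ℤ/2)²` exactly in the `r₈ = 0` case);
mechanism: Cassels–Tate pairing on `Ш[φ] = ⟨−p, −ℓ⟩`, template Wang–Zhang 2022 Thm 1.1 / TYZ 2017. -/
def J0L8 : Prop :=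
  ∀ (p ℓ : ℕ), IsX12Pair p ℓ →
  ∀ (K : Type) [Field K] [NumberField K], IsImaginaryQuadratic K →
    NumberField.discr K = -(3 * p * ℓ : ℤ) → ¬ 16 ∣ NumberField.classNumber K →
    (E36.quadraticTwist ((p : ℚ) * ℓ)).entireLFunction 1 ≠ 0

/-- **LINNIK-2 supply** (open; immediate under GRH for the Hecke `L`-functions of `ℚ(√3p)(√α₀)`):
for every large prime `p ≡ 11 (mod 12)` there is an X12 partner `ℓ < p² / (log p)²` whose
`r₈`-bit vanishes, phrased through `R8X12` as a checkable congruence on a representation. -/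
def Linnik2Supply : Prop :=
  ∃ p₀ : ℕ, ∀ p : ℕ, p₀ ≤ p → p.Prime → p % 12 = 11 →
    ∃ ℓ : ℕ, IsX12Pair p ℓ ∧ (ℓ : ℝ) * Real.log p ^ 2 < (p : ℝ) ^ 2 ∧
      ∃ (x y z : ℤ), x ^ 2 + ℓ * z ^ 2 = 3 * p * y ^ 2 ∧ Int.gcd x z = 1 ∧ ¬ (4 : ℤ) ∣ z ∧
        (x % 12 = 5 ∨ x % 12 = 7)

/-- Sanity: the twist used in `J0L8` is literally `y² = x³ + (pℓ)³`. -/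
example (M : ℚ) : E36.quadraticTwist M = ⟨0, 0, 0, 0, M ^ 3⟩ := by
  simp [E36, WeierstrassCurve.quadraticTwist, WeierstrassCurve.b₂, WeierstrassCurve.b₄,
    WeierstrassCurve.b₆]

/-- Sanity instance of the X12 corner: `(p, ℓ) = (11, 167)` (`(167/11) = −1`). -/
example : IsX12Pair 11 167 := by
  refine ⟨by norm_num, by norm_num, by norm_num, by norm_num, ?_⟩
  push_cast
  norm_num [jacobiSym.mod_left]

end Summit.BirchSwinnertonDyer.BirchSwinnertonDyer.Cruxes.HeegnerTwistCouplingInSupply.TransferG20
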